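import Literature.Computability.AlgebraicComplexity.MultiYoungSymmetrizerRank
import HarnessLib

/-!
# `c^λ_{μ¹…μ^d} = ⟨Res χ^λ, χ^{μ¹} ⊠ ⋯ ⊠ χ^{μ^d}⟩`: the multi-Littlewood–Richardson coefficient
# as a character sum over the Young subgroup

Topic `Literature/Computability/AlgebraicComplexity` (val-lit cell, board U1 = `IK2020_prop_10_1`,
brick **B2** of part P2 of `HOME/bip/NOTE-t08g3-IK2020Prop101-route.md`; continues
`MultiYoungSymmetrizerRank.lean`). Theorems only: no definitions, no named facts.

Fulton–Harris §4.3 ((4.41)–(4.43), Ex. 4.44; proof of the Littlewood–Richardson rule via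
Frobenius reciprocity, p. 58–59): the Littlewood–Richardson number `c^λ_{μν}` — the multiplicity of
`{λ}` in `{μ} ⊗ {ν}`, equivalently of `S_λ` in `c_μ c_ν · V^{⊗(|μ|+|ν|)}` — is the multiplicity
`⟨Res^{𝔖_n}_{𝔖_{|μ|}×𝔖_{|ν|}} χ^λ, χ^μ ⊠ χ^ν⟩`. This file proves the `d`-block version for IK's
`multiLRCoeff` (Ikenmeyer–Kandasamy 2020 §3):

  `(∏_i n_i!) · c^λ_{μ¹…μ^d} = ∑_{y ∈ 𝔖_{n₁} × ⋯ × 𝔖_{n_d}} (∏_i χ^{μ^i}(y_i)) · χ^λ(y₁ ⋯ y_d)`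
  (`IK2020.prod_factorial_mul_multiLRCoeff_eq_sum`, `ℓ(λ) ≤ N`, characteristic zero),

where `y₁ ⋯ y_d ∈ 𝔖_n` is the product of the block permutations (`IK2020.blockPermHom`).

## Proof

* §1 (expansion) `prod_ofFn_mapDomainAlgHom_eq_sum`: for group-algebra elements `b_i ∈ k[H_i]`
  pushed into `k[G]` along `φ ∘ ι_i` (`φ : ∏ H_i → G`, `ι_i` the `i`-th injection),
  `∏_i φ_*(ι_i)_*(b_i) = ∑_{y ∈ ∏ H_i} (∏_i b_i(y_i)) · φ(y)` — both sides are multilinear in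
  `(b_i)` (`MultilinearMap.mkPiAlgebraFin`, `Basis.ext_multilinear` on the bases of group
  elements), and on group elements it is `∏_i φ(ι_i(y_i)) = φ(y)`.
* §2 (trace and conjugation) hence `∑_g (∏_i …)(g) χ(g) = ∑_y (∏_i b_i(y_i)) χ(φ y)`; averaging
  each block over conjugation (characters are class functions, `Representation.char_conj`) and
  the tree's `n_μ χ^μ(x) = ∑_z c_μ(z⁻¹ x⁻¹ z)` (`coeff_sq_mul_spechtCharacter_eq_sum`) turn
  `c_{μ^i}` into `(n_{μ^i}/n_i!) χ^{μ^i}`.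
* §3 combine with `IK2020.prod_mul_multiLRCoeff_eq_sum`
  (`(∏ n_{μ^i}) c^λ_{μ•} = ∑_g c_{μ•}(g) χ^λ(g)`) and cancel `∏ n_{μ^i} ≠ 0`.

Honest framing: finite-group character bookkeeping; nothing here bears on VP versus VNP, which
is NOT proved.

## References

* [FultonHarrisGTM129] W. Fulton, J. Harris, *Representation Theory*, GTM 129: §2.1 Prop. 2.1,
  §2.4 (2.32), §4.3 (4.41)–(4.43), Ex. 4.44, Lemma 4.26.
* [IkenmeyerKandasamy2019] C. Ikenmeyer, U. Kandasamy, arXiv:1911.03990, §3.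
-/

noncomputable section

open scoped BigOperators

namespace Literature.Computability.AlgebraicComplexity

open _root_.Literature.NumberTheory.DiophantineGeometry

/-! ### §1 Expansion of a product of pushed-forward group-algebra elements -/

section Expansion

variable (k : Type*) [Field k] {d : ℕ} {H : Fin d → Type*} [∀ i, Group (H i)]
  {G : Type*} [Group G]

/-- The product of the injections of the coordinates is the element: `∏_i ι_i(y_i) = y` in
`∏_i H_i` (list product in the order of `Fin d`; Mathlib's `Finset.noncommProd_mulSingle`).
[folklore] -/
private theorem prod_ofFn_mulSingle (y : (i : Fin d) → H i) :
    (List.ofFn fun i => Pi.mulSingle i (y i)).prod = y := by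
  classical
  have h1 : (List.ofFn fun i => Pi.mulSingle (M := H) i (y i)).prod =
      (List.finRange d).toFinset.noncommProd (fun i => Pi.mulSingle (M := H) i (y i))
        (fun i _ j _ _ => Pi.mulSingle_apply_commute y i j) := by
    rw [Finset.noncommProd_toFinset _ _ _ (List.nodup_finRange d), List.ofFn_eq_map]
  rw [h1]
  have h2 := Finset.noncommProd_mulSingle (M := H) y
  convert h2 using 2
  exact List.toFinset_finRange d

/-- **Expansion**: for `b_i ∈ k[H_i]` and a homomorphism `φ : ∏_i H_i → G`,
`∏_i (φ ∘ ι_i)_*(b_i) = ∑_{y ∈ ∏_i H_i} (∏_i b_i(y_i)) · φ(y)` in `k[G]` (ordered list product on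
the left; the factors commute). Both sides are multilinear in `(b_i)_i` and agree on group
elements. (The structure of the group algebra of a direct product, Fulton–Harris Ex. 2.36 /
§4.3 before (4.41).) [cite: FultonHarrisGTM129, §4.3 (4.41)] -/
theorem prod_ofFn_mapDomainAlgHom_eq_sum [∀ i, Fintype (H i)] [∀ i, DecidableEq (H i)]
    (φ : ((i : Fin d) → H i) →* G) (b : (i : Fin d) → MonoidAlgebra k (H i)) :
    (List.ofFn fun i =>
        MonoidAlgebra.mapDomainAlgHom k k (φ.comp (MonoidHom.mulSingle H i)) (b i)).prod =
      ∑ y : ((i : Fin d) → H i),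
        (∏ i, (b i).coeff (y i)) • MonoidAlgebra.single (φ y) (1 : k) := by
  classical
  -- the two sides as multilinear maps
  let L : MultilinearMap k (fun i => MonoidAlgebra k (H i)) (MonoidAlgebra k G) :=
    (MultilinearMap.mkPiAlgebraFin k d (MonoidAlgebra k G)).compLinearMap
      fun i => (MonoidAlgebra.mapDomainAlgHom k k (φ.comp (MonoidHom.mulSingle H i))).toLinearMap
  let cf : (i : Fin d) → MonoidAlgebra k (H i) →ₗ[k] (((j : Fin d) → H j) → k) := fun i =>
    (LinearMap.funLeft k k fun y : ((j : Fin d) → H j) => y i) ∘ₗ Finsupp.lcoeFun ∘ₗ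
      (MonoidAlgebra.coeffLinearEquiv k).toLinearMap
  let P : MultilinearMap k (fun i => MonoidAlgebra k (H i)) (((j : Fin d) → H j) → k) :=
    (MultilinearMap.mkPiAlgebra k (Fin d) (((j : Fin d) → H j) → k)).compLinearMap cf
  let S : (((j : Fin d) → H j) → k) →ₗ[k] MonoidAlgebra k G :=
    ∑ y : ((j : Fin d) → H j), (LinearMap.proj y).smulRight (MonoidAlgebra.single (φ y) (1 : k))
  let R : MultilinearMap k (fun i => MonoidAlgebra k (H i)) (MonoidAlgebra k G) :=
    S.compMultilinearMap P
  have hL : ∀ b' : (i : Fin d) → MonoidAlgebra k (H i), L b' = (List.ofFn fun i =>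
      MonoidAlgebra.mapDomainAlgHom k k (φ.comp (MonoidHom.mulSingle H i)) (b' i)).prod := by
    intro b'
    simp only [L, MultilinearMap.compLinearMap_apply, MultilinearMap.mkPiAlgebraFin_apply,
      AlgHom.toLinearMap_apply]
  have hcf : ∀ (b' : (i : Fin d) → MonoidAlgebra k (H i)) i y,
      cf i (b' i) y = (b' i).coeff (y i) := by
    intro b' i y
    simp only [cf, LinearMap.coe_comp, Function.comp_apply, LinearEquiv.coe_coe,
      MonoidAlgebra.coeffLinearEquiv_apply, Finsupp.lcoeFun_apply, LinearMap.funLeft_apply]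
  have hR : ∀ b' : (i : Fin d) → MonoidAlgebra k (H i), R b' =
      ∑ y : ((i : Fin d) → H i), (∏ i, (b' i).coeff (y i)) •
        MonoidAlgebra.single (φ y) (1 : k) := by
    intro b'
    simp only [R, S, P, LinearMap.compMultilinearMap_apply, MultilinearMap.compLinearMap_apply,
      MultilinearMap.mkPiAlgebra_apply, LinearMap.sum_apply, LinearMap.smulRight_apply,
      LinearMap.proj_apply, Finset.prod_apply, hcf]
  have hLR : L = R := by
    refine Module.Basis.ext_multilinear (fun i => MonoidAlgebra.basis (H i) k) fun v => ?_
    rw [hL, hR]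
    simp only [MonoidAlgebra.basis_apply]
    -- left: a product of group elements
    have hl : (List.ofFn fun i => MonoidAlgebra.mapDomainAlgHom k k
        (φ.comp (MonoidHom.mulSingle H i)) (MonoidAlgebra.single (v i) 1)).prod =
        MonoidAlgebra.single (φ v) (1 : k) := by
      have h1 : (fun i => MonoidAlgebra.mapDomainAlgHom k k (φ.comp (MonoidHom.mulSingle H i))
          (MonoidAlgebra.single (v i) (1 : k))) =
          ⇑((MonoidAlgebra.of k G).comp φ) ∘ fun i => Pi.mulSingle i (v i) := by
        funext i
        rw [Function.comp_apply, MonoidAlgebra.mapDomainAlgHom_apply,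
          MonoidAlgebra.mapDomain_single, MonoidHom.comp_apply, MonoidHom.mulSingle_apply,
          MonoidHom.comp_apply, MonoidAlgebra.of_apply]
      rw [h1, ← List.map_ofFn, ← map_list_prod, prod_ofFn_mulSingle, MonoidHom.comp_apply,
        MonoidAlgebra.of_apply]
    -- right: only `y = v` survives
    have hr : ∑ y : ((i : Fin d) → H i), (∏ i, (MonoidAlgebra.single (v i) (1 : k)).coeff (y i)) •
        MonoidAlgebra.single (φ y) (1 : k) = MonoidAlgebra.single (φ v) (1 : k) := by
      rw [Finset.sum_eq_single v]
      · rw [Finset.prod_eq_one fun i _ => ?_, one_smul]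
        rw [MonoidAlgebra.coeff_single, Finsupp.single_eq_same]
      · intro y _ hy
        obtain ⟨i, hi⟩ := Function.ne_iff.mp hy
        rw [Finset.prod_eq_zero (Finset.mem_univ i), zero_smul]
        rw [MonoidAlgebra.coeff_single, Finsupp.single_eq_of_ne hi]
      · intro h
        exact absurd (Finset.mem_univ v) h
    rw [hl, hr]
  have := congrArg
    (fun f : MultilinearMap k (fun i => MonoidAlgebra k (H i)) (MonoidAlgebra k G) => f b) hLR
  simp only [hL, hR] at this
  exact this

/-- Trace form of the expansion: against any function `χ` on `G`,
`∑_g (∏_i (φ ∘ ι_i)_*(b_i))(g) χ(g) = ∑_{y} (∏_i b_i(y_i)) χ(φ y)`.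
[cite: FultonHarrisGTM129, §4.3 (4.41)] -/
theorem sum_coeff_prod_ofFn_mapDomainAlgHom_mul [Fintype G] [DecidableEq G] [∀ i, Fintype (H i)]
    [∀ i, DecidableEq (H i)] (φ : ((i : Fin d) → H i) →* G)
    (b : (i : Fin d) → MonoidAlgebra k (H i)) (χ : G → k) :
    ∑ g, ((List.ofFn fun i =>
        MonoidAlgebra.mapDomainAlgHom k k (φ.comp (MonoidHom.mulSingle H i)) (b i)).prod).coeff g *
        χ g =
      ∑ y : ((i : Fin d) → H i), (∏ i, (b i).coeff (y i)) * χ (φ y) := by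
  rw [prod_ofFn_mapDomainAlgHom_eq_sum]
  simp only [MonoidAlgebra.coeff_sum, MonoidAlgebra.coeff_smul, MonoidAlgebra.coeff_single,
    Finsupp.coe_finsetSum, Finsupp.coe_smul, Finset.sum_apply, Pi.smul_apply, smul_eq_mul,
    Finset.sum_mul]
  rw [Finset.sum_comm]
  refine Finset.sum_congr rfl fun y _ => ?_
  simp_rw [mul_assoc, ← Finset.mul_sum]
  congr 1
  rw [Finset.sum_eq_single (φ y)]
  · rw [Finsupp.single_eq_same, one_mul]
  · intro g _ hg
    rw [Finsupp.single_eq_of_ne hg, zero_mul]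
  · intro h
    exact absurd (Finset.mem_univ _) h

end Expansion

/-! ### §2 Blockwise conjugation averaging -/

section Averaging

variable (k : Type*) [Field k] {d : ℕ} {H : Fin d → Type*} [∀ i, Group (H i)]
  {G : Type*} [Group G] {M : Type*} [AddCommGroup M] [Module k M]

/-- **Blockwise conjugation average**: characters are class functions (Fulton–Harris Prop. 2.1),
so in `∑_y (∏_i b_i(y_i)) χ_ρ(φ y)` each `b_i` may be replaced by its average over conjugation in
`H_i`: `|∏ H_i| · ∑_y (∏_i b_i(y_i)) χ_ρ(φ y) = ∑_y (∏_i ∑_{z ∈ H_i} b_i(z⁻¹ y_i z)) χ_ρ(φ y)`.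
[cite: FultonHarrisGTM129, §2.1 Prop. 2.1] -/
theorem card_mul_sum_prod_coeff_mul_character [∀ i, Fintype (H i)] [∀ i, DecidableEq (H i)]
    (φ : ((i : Fin d) → H i) →* G) (ρ : Representation k G M)
    (b : (i : Fin d) → MonoidAlgebra k (H i)) :
    (Fintype.card ((i : Fin d) → H i) : k) *
        ∑ y : ((i : Fin d) → H i), (∏ i, (b i).coeff (y i)) * ρ.character (φ y) =
      ∑ y : ((i : Fin d) → H i),
        (∏ i, ∑ z : H i, (b i).coeff (z⁻¹ * y i * z)) * ρ.character (φ y) := by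
  classical
  have hconj : ∀ z : ((i : Fin d) → H i),
      ∑ y : ((i : Fin d) → H i), (∏ i, (b i).coeff (y i)) * ρ.character (φ y) =
        ∑ y : ((i : Fin d) → H i), (∏ i, (b i).coeff ((z i)⁻¹ * y i * z i)) *
          ρ.character (φ y) := by
    intro z
    refine Fintype.sum_equiv ((Equiv.mulLeft z).trans (Equiv.mulRight z⁻¹)) _ _ fun y => ?_
    simp only [Equiv.trans_apply, Equiv.coe_mulLeft, Equiv.coe_mulRight, Pi.mul_apply,
      Pi.inv_apply, map_mul, map_inv, Representation.char_conj]
    congr 1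
    refine Finset.prod_congr rfl fun i _ => ?_
    congr 1
    group
  calc (Fintype.card ((i : Fin d) → H i) : k) *
        ∑ y : ((i : Fin d) → H i), (∏ i, (b i).coeff (y i)) * ρ.character (φ y)
      = ∑ z : ((i : Fin d) → H i), ∑ y : ((i : Fin d) → H i),
          (∏ i, (b i).coeff ((z i)⁻¹ * y i * z i)) * ρ.character (φ y) := by
        rw [Finset.sum_congr rfl fun z _ => (hconj z).symm, Finset.sum_const, Finset.card_univ,
          nsmul_eq_mul]
    _ = ∑ y : ((i : Fin d) → H i), (∑ z : ((i : Fin d) → H i),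
          ∏ i, (b i).coeff ((z i)⁻¹ * y i * z i)) * ρ.character (φ y) := by
        rw [Finset.sum_comm]
        exact Finset.sum_congr rfl fun y _ => by rw [Finset.sum_mul]
    _ = ∑ y : ((i : Fin d) → H i),
          (∏ i, ∑ z : H i, (b i).coeff (z⁻¹ * y i * z)) * ρ.character (φ y) := by
        refine Finset.sum_congr rfl fun y _ => ?_
        rw [Finset.prod_univ_sum (fun _ => Finset.univ)
          (fun i (z : H i) => (b i).coeff (z⁻¹ * y i * z)), Fintype.piFinset_univ]

/-- The conjugation average of a Young symmetrizer is `n_μ χ^μ`: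
`∑_{z ∈ 𝔖_m} c_μ(z⁻¹ x z) = n_μ χ^μ(x)` (the tree's `coeff_sq_mul_spechtCharacter_eq_sum` at `x⁻¹`,
`χ^μ(x⁻¹) = χ^μ(x)`). [cite: FultonHarrisGTM129, §2.4 (2.32)] -/
theorem sum_coeff_conj_youngSymmetrizer [CharZero k] {m : ℕ} (μ : Nat.Partition m)
    (x : Equiv.Perm (Fin m)) :
    ∑ z : Equiv.Perm (Fin m), (youngSymmetrizer k μ).coeff (z⁻¹ * x * z) =
      (youngSymmetrizer k μ * youngSymmetrizer k μ).coeff 1 * spechtCharacter k μ x := by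
  rw [← spechtCharacter_inv k μ x, coeff_sq_mul_spechtCharacter_eq_sum k μ x⁻¹, inv_inv]

end Averaging

/-! ### §3 `(∏_i n_i!) · c^λ_{μ•} = ∑_y (∏_i χ^{μ^i}(y_i)) χ^λ(y₁ ⋯ y_d)` -/

section Frobenius

variable (k : Type*) [Field k] [CharZero k] {N d : ℕ} {n : Fin d → ℕ}

/-- The product of the block permutations `y₁ ⋯ y_d ∈ 𝔖_n` (through `IK2020.blockPermHom`) is the
image of `y ∈ ∏ 𝔖_{n_i}` under the Young-subgroup embedding. [folklore] -/
private theorem prod_ofFn_blockPermHom (y : (i : Fin d) → Equiv.Perm (Fin (n i))) :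
    (List.ofFn fun i => IK2020.blockPermHom n i (y i)).prod =
      ((Equiv.permCongrHom (finSigmaFinEquiv (n := n))).toMonoidHom.comp
        (Equiv.Perm.sigmaCongrRightHom fun j => Fin (n j))) y := by
  classical
  have h : (fun i => IK2020.blockPermHom n i (y i)) =
      ⇑((Equiv.permCongrHom (finSigmaFinEquiv (n := n))).toMonoidHom.comp
        (Equiv.Perm.sigmaCongrRightHom fun j => Fin (n j))) ∘ fun i => Pi.mulSingle i (y i) := by
    funext i
    rw [Function.comp_apply, IK2020.blockPermHom, MonoidHom.comp_apply, MonoidHom.mulSingle_apply]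
  rw [h, ← List.map_ofFn, ← map_list_prod, prod_ofFn_mulSingle]

/-- **`c^λ_{μ¹…μ^d} = ⟨Res χ^λ, χ^{μ¹} ⊠ ⋯ ⊠ χ^{μ^d}⟩_{𝔖_{n₁}×⋯×𝔖_{n_d}}`** in sum form
(`ℓ(λ) ≤ N`, characteristic zero):
`(∏_i n_i!) · c^λ_{μ•} = ∑_{y ∈ ∏_i 𝔖_{n_i}} (∏_i χ^{μ^i}(y_i)) · χ^λ(y₁ ⋯ y_d)`, `y₁ ⋯ y_d` the
product of the block permutations in `𝔖_n`. Fulton–Harris (4.41)–(4.43) / Ex. 4.44 (the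
Littlewood–Richardson number as the multiplicity of `χ^μ ⊠ χ^ν` in `Res χ^λ`), here from the trace
of the product Young symmetrizer (`IK2020.prod_mul_multiLRCoeff_eq_sum`), the expansion of §1 and
the blockwise conjugation average of §2. [cite: FultonHarrisGTM129, §4.3 (4.41)–(4.43)]
[cite: IkenmeyerKandasamy2019, §3] -/
theorem IK2020.prod_factorial_mul_multiLRCoeff_eq_sum (μ : (i : Fin d) → Nat.Partition (n i))
    (lam : Nat.Partition (∑ j, n j)) (hlam : lam.parts.card ≤ N) :
    (∏ i, ((n i).factorial : k)) * (IK2020.multiLRCoeff k N μ lam : k) =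
      ∑ y : ((i : Fin d) → Equiv.Perm (Fin (n i))),
        (∏ i, spechtCharacter k (μ i) (y i)) *
          spechtCharacter k lam (List.ofFn fun i => IK2020.blockPermHom n i (y i)).prod := by
  classical
  set ψ : ((i : Fin d) → Equiv.Perm (Fin (n i))) →* Equiv.Perm (Fin (∑ j, n j)) :=
    (Equiv.permCongrHom (finSigmaFinEquiv (n := n))).toMonoidHom.comp
      (Equiv.Perm.sigmaCongrRightHom fun j => Fin (n j)) with hψ
  set C : k := ∏ i, (youngSymmetrizer k (μ i) * youngSymmetrizer k (μ i)).coeff 1 with hC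
  have hC0 : C ≠ 0 := IK2020.prod_coeff_sq_youngSymmetrizer_ne_zero k μ
  -- `C · c^λ = ∑_g c_{μ•}(g) χ^λ(g) = ∑_y (∏ c_{μ^i}(y_i)) χ^λ(ψ y)`
  have h1 := IK2020.prod_mul_multiLRCoeff_eq_sum k μ lam hlam
  have h2 : ∑ g : Equiv.Perm (Fin (∑ j, n j)),
      (IK2020.multiYoungSymmetrizer k μ).coeff g * spechtCharacter k lam g =
      ∑ y : ((i : Fin d) → Equiv.Perm (Fin (n i))),
        (∏ i, (youngSymmetrizer k (μ i)).coeff (y i)) * spechtCharacter k lam (ψ y) := by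
    unfold IK2020.multiYoungSymmetrizer IK2020.blockPermHom
    exact sum_coeff_prod_ofFn_mapDomainAlgHom_mul k ψ (fun i => youngSymmetrizer k (μ i))
      (spechtCharacter k lam)
  -- blockwise conjugation average, with `χ^λ` the character of `HW_λ((k^N)^{⊗n})`
  have h3 := card_mul_sum_prod_coeff_mul_character k ψ
    (hwPermRep k (D := ∑ j, n j) (Weight.ofPartition N lam)) (fun i => youngSymmetrizer k (μ i))
  rw [character_hwPermRep k lam hlam, Fintype.card_pi] at h3
  simp only [Fintype.card_perm, Fintype.card_fin, Nat.cast_prod,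
    sum_coeff_conj_youngSymmetrizer, Finset.prod_mul_distrib] at h3
  -- `h3 : (∏ n_i!) * ∑_y (∏ c_i(y_i)) χ(ψ y) = ∑_y (C * ∏ χ^{μ^i}(y_i)) * χ(ψ y)`
  have h4 : ∑ y : ((i : Fin d) → Equiv.Perm (Fin (n i))),
      (C * ∏ i, spechtCharacter k (μ i) (y i)) * spechtCharacter k lam (ψ y) =
      C * ∑ y : ((i : Fin d) → Equiv.Perm (Fin (n i))),
        (∏ i, spechtCharacter k (μ i) (y i)) * spechtCharacter k lam (ψ y) := by
    rw [Finset.mul_sum]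
    exact Finset.sum_congr rfl fun y _ => by rw [mul_assoc]
  simp_rw [prod_ofFn_blockPermHom]
  rw [← hC] at h1 h3
  apply mul_left_cancel₀ hC0
  rw [← h4, ← h3, ← h2, ← h1, mul_left_comm]

end Frobenius

end Literature.Computability.AlgebraicComplexity

end
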